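import Literature.NumberTheory.Sieve.BombieriFriedlanderIwaniecDispersionSmoothing
import Literature.NumberTheory.Sieve.BombieriFriedlanderIwaniecTheorem5Poisson
import Literature.NumberTheory.Sieve.DivisorPowerSums
import HarnessLib

/-!
# Bombieri–Friedlander–Iwaniec 1986, §4: `𝒮₃ = f̂(0) X + ℛ₃`

Topic `Literature/NumberTheory/Sieve`.  Second file of the formalisation of the provable part of
the proof of Theorem 1 of E. Bombieri, J. B. Friedlander, H. Iwaniec, *Primes in arithmetic
progressions to large moduli*, Acta Math. 156 (1986), 203–251, continuing
`…BombieriFriedlanderIwaniecDispersionSmoothing` (§3: `𝒢 ≤ 𝒢*(f) = 𝒮₁ − 2𝒮₂ + 𝒮₃`).  This is §4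
(p. 216), "Evaluation of `𝒮₃`", the simplest of the three sums, for BFI's smooth weight
`f = BFI.bump M Y` (of `…Theorem5Weights`).  Everything here is PROVED; no named facts are
introduced.

## Contents (BFI §4, p. 216)

* `BFI.cSum N β d = ∑_{n ∼ N, (n, d) = 1} β_n`, `BFI.sum_mul_copW`, `BFI.abs_cSum_le`.
* `BFI.mainX a N Q R β γ` — **the main term `X`** of (4.1):
  `X = ∑_{(a, q₁q₂r)=1} γ_{q₁} γ_{q₂} Φ(q₁,q₂,r) (∑_{(n,q₁r)=1} β_n)(∑_{(n,q₂r)=1} β_n)`,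
  `Φ = φ(q₁q₂r)/(q₁q₂r φ(q₁r) φ(q₂r))`.
* `BFI.dS3_eq` — the two `n`-sums of `𝒮₃` separate.
* **`BFI.norm_coprimeSum_sub_le_sigma`** — the first display of §4, "By Poisson's formula (Lemma 2)
  we get `∑_{(m,b)=1} f(m) = (φ(b)/b) f̂(0) + O(τ(b))`", in the explicit form
  `‖A*(k) − α̂₀ φ(k)/k‖ ≤ (2(M+2Y)/Y + K₂) τ(k)` for `0 < Y ≤ M`, `k ≥ 1` (`A* = BFI.coprimeSum`,
  `α̂₀ = BFI.alphaHat = f̂(0)`, `K₂ = BFI.derivConst 2`): the tree's `BFI.norm_coprimeSum_sub_le`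
  (Möbius inversion and Poisson summation modulo each `d ∣ k`) with the split points
  `K(d) = ⌊d/Y⌋`, which makes the error uniform in `k` apart from the factor `τ(k)`.
* `BFI.mA3_bump_eq` (`A₃ = [(q₁q₂r,a)=1] A*(q₁q₂r)`), `BFI.norm_dS3_term_sub_le`, and
  **`BFI.norm_dS3_sub_mainX_le`** — (4.1)–(4.2):
  `‖𝒮₃ − f̂(0) X‖ ≤ (2(M+2Y)/Y + K₂) ∑_{r∼R} ∑_{q₁,q₂∼Q} |γ_{q₁}γ_{q₂}| τ(q₁q₂r) (∑_{n∼N}|β_n|)²/(φ(q₁r)φ(q₂r))`.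

## Faithfulness

BFI state (4.2) as `ℛ₃ ≪ N‖β‖²R⁻¹ℒ^B` after averaging the `O(τ(b))` errors against (A₃)
(`|γ_q| ≤ τ(q)^B`) and Cauchy's inequality `(∑|β_n|)² ≤ N‖β‖²`; here the bound is kept in the
un-averaged explicit form above (valid for all real `β, γ`), the divisor-sum averaging being done
once, where the error terms of §§4–7 are collected.  The main term is kept with the complex
constant `α̂₀ = 𝓕f(0) = ∫ f` of `…Theorem5Poisson` (so the statement is about
`‖(𝒮₃ : ℂ) − α̂₀ X‖`); it cancels against the main terms of `𝒮₁` and `𝒮₂` later exactly as in (3.4).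

## References

* E. Bombieri, J. B. Friedlander, H. Iwaniec, Acta Math. 156 (1986), 203–251, §4 p. 216,
  (4.1)–(4.2). [BombieriFriedlanderIwaniecActa1986]
-/

noncomputable section

open Finset Real
open scoped ArithmeticFunction.sigma

namespace Literature.NumberTheory.Sieve

namespace BFI

/-! ### Coprime-restricted sums of `β` and the main term `X` of (4.1) -/

/-- `∑_{n ∼ N, (n, d) = 1} β_n`. [folklore] -/
def cSum (N : ℝ) (β : ℕ → ℝ) (d : ℕ) : ℝ := ∑ n ∈ dyadic N, if n.Coprime d then β n else 0

/-- `∑_{n∼N} β_n · [(n,d)=1]/φ(d) = (∑_{(n,d)=1} β_n)/φ(d)`. [folklore] -/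
theorem sum_mul_copW (N : ℝ) (β : ℕ → ℝ) (d : ℕ) :
    ∑ n ∈ dyadic N, β n * copW n d = cSum N β d / (Nat.totient d : ℝ) := by
  unfold cSum copW
  rw [Finset.sum_div]
  refine Finset.sum_congr rfl fun n _ => ?_
  split_ifs <;> ring

/-- `|∑_{(n,d)=1} β_n| ≤ ∑ |β_n|`. [folklore] -/
theorem abs_cSum_le (N : ℝ) (β : ℕ → ℝ) (d : ℕ) : |cSum N β d| ≤ ∑ n ∈ dyadic N, |β n| := by
  unfold cSum
  refine (Finset.abs_sum_le_sum_abs _ _).trans (Finset.sum_le_sum fun n _ => ?_)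
  split_ifs <;> simp

/-- **The main term `X`** of BFI (4.1), p. 216:
`X = ∑_{(a, r q₁ q₂) = 1} Φ(q₁, q₂, r) γ_{q₁} γ_{q₂} ∑_{(nᵢ, qᵢ r) = 1} β_{n₁} β_{n₂}` with
`Φ(q₁, q₂, r) = φ(q₁q₂r)/(q₁q₂r φ(q₁r) φ(q₂r))` (ranges `r ∼ R`, `qᵢ ∼ Q`, `nᵢ ∼ N`).
[cite: BombieriFriedlanderIwaniecActa1986, §4 (4.1) p. 216] -/
def mainX (a : ℤ) (N Q R : ℝ) (β γ : ℕ → ℝ) : ℝ :=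
  ∑ r ∈ dyadic R, ∑ q₁ ∈ dyadic Q, ∑ q₂ ∈ dyadic Q,
    if IsCoprime ((q₁ * q₂ * r : ℕ) : ℤ) a then
      γ q₁ * γ q₂ * (cSum N β (q₁ * r) / (Nat.totient (q₁ * r) : ℝ)) *
        (cSum N β (q₂ * r) / (Nat.totient (q₂ * r) : ℝ)) *
        ((Nat.totient (q₁ * q₂ * r) : ℝ) / ((q₁ * q₂ * r : ℕ) : ℝ))
    else 0

/-- `𝒮₃` factorised: the two `n`-sums separate,
`𝒮₃ = ∑_{r, q₁, q₂} γ_{q₁} γ_{q₂} (∑_{(n,q₁r)=1} β/φ(q₁r)) (∑_{(n,q₂r)=1} β/φ(q₂r)) A₃(r,q₁,q₂)`.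
[cite: BombieriFriedlanderIwaniecActa1986, §3–4 pp. 215–216] -/
theorem dS3_eq (a : ℤ) (S : Finset ℕ) (N Q R : ℝ) (w β γ : ℕ → ℝ) :
    dS3 a S N Q R w β γ = ∑ r ∈ dyadic R, ∑ q₁ ∈ dyadic Q, ∑ q₂ ∈ dyadic Q,
      γ q₁ * γ q₂ * (cSum N β (q₁ * r) / (Nat.totient (q₁ * r) : ℝ)) *
        (cSum N β (q₂ * r) / (Nat.totient (q₂ * r) : ℝ)) * mA3 a S w r q₁ q₂ := by
  unfold dS3
  refine Finset.sum_congr rfl fun r _ => Finset.sum_congr rfl fun q₁ _ =>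
    Finset.sum_congr rfl fun q₂ _ => ?_
  rw [← sum_mul_copW, ← sum_mul_copW]
  rw [show γ q₁ * γ q₂ * (∑ n ∈ dyadic N, β n * copW n (q₁ * r)) *
      (∑ n ∈ dyadic N, β n * copW n (q₂ * r)) * mA3 a S w r q₁ q₂ =
      (γ q₁ * γ q₂ * mA3 a S w r q₁ q₂) * ((∑ n ∈ dyadic N, β n * copW n (q₁ * r)) *
        (∑ n ∈ dyadic N, β n * copW n (q₂ * r))) by ring, Finset.sum_mul_sum, Finset.mul_sum]
  refine Finset.sum_congr rfl fun n₁ _ => ?_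
  rw [Finset.mul_sum]
  refine Finset.sum_congr rfl fun n₂ _ => ?_
  ring

/-! ### The coprimality sum of the smooth weight: `∑_{(m,k)=1} f(m) = f̂(0) φ(k)/k + O(τ(k))` -/

/-- **`∑_{(m, b) = 1} f(m) = (φ(b)/b) f̂(0) + O(τ(b))`** (BFI §4, p. 216, first display: "By
Poisson's formula (Lemma 2) we get …"), for `f = BFI.bump M Y` with `0 < Y ≤ M`, in the explicit form
`‖A*(k) − α̂₀ φ(k)/k‖ ≤ (2(M+2Y)/Y + K₂) τ(k)`: `BFI.norm_coprimeSum_sub_le` with the split points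
`K(d) = ⌊d/Y⌋` (no frequency is truncated for `d < Y`; for `d ≥ Y` the `⌊d/Y⌋` frequencies counted
trivially cost `≤ 2(M+2Y)/Y` and the tail `≤ (4/π²) K₂`).
[cite: BombieriFriedlanderIwaniecActa1986, §4 p. 216] -/
theorem norm_coprimeSum_sub_le_sigma {M Y : ℝ} (hY : 0 < Y) (hYM : Y ≤ M) {k : ℕ} (hk : 0 < k) :
    ‖(coprimeSum M Y k : ℂ) - alphaHat M Y * ((Nat.totient k : ℂ) / k)‖ ≤
      (2 * (M + 2 * Y) / Y + derivConst 2) * (σ 0 k : ℝ) := by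
  have hM : 0 ≤ M := hY.le.trans hYM
  refine (norm_coprimeSum_sub_le hY hYM hk (le_refl 2) (fun d => ⌊(d : ℝ) / Y⌋₊)).trans ?_
  have hterm : ∀ d ∈ k.divisors, (d : ℝ)⁻¹ * (2 * (⌊(d : ℝ) / Y⌋₊ : ℕ) * (M + 2 * Y) +
      tailBound Y 2 d ⌊(d : ℝ) / Y⌋₊) ≤ 2 * (M + 2 * Y) / Y + derivConst 2 := by
    intro d hd
    have hd0 : (0 : ℝ) < d := by exact_mod_cast Nat.pos_of_mem_divisors hd
    set K : ℕ := ⌊(d : ℝ) / Y⌋₊ with hK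
    have hKle : (K : ℝ) ≤ d / Y := Nat.floor_le (by positivity)
    have hKlt : (d : ℝ) / Y < K + 1 := Nat.lt_floor_add_one _
    have hK2 := one_le_derivConst 2
    rw [mul_add]
    refine add_le_add ?_ ?_
    · -- the trivially counted frequencies
      calc (d : ℝ)⁻¹ * (2 * (K : ℝ) * (M + 2 * Y)) ≤ (d : ℝ)⁻¹ * (2 * (d / Y) * (M + 2 * Y)) := by
            gcongr
        _ = 2 * (M + 2 * Y) / Y := by field_simp
    · -- the tail
      unfold tailBound
      have hπ : (4 : ℝ) ≤ π ^ 2 := by nlinarith [Real.pi_gt_three]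
      have hK1 : ((K : ℝ) + 1)⁻¹ ≤ Y / d := by
        rw [inv_le_comm₀ (by positivity) (by positivity), inv_div]
        exact hKlt.le
      calc (d : ℝ)⁻¹ * (16 * derivConst 2 * Y⁻¹ ^ 2 * Y * ((d : ℝ) / (2 * π)) ^ 2 *
              (((K : ℝ) + 1) ^ (2 - 1))⁻¹)
          = (4 * derivConst 2 * (d : ℝ) / (π ^ 2 * Y)) * ((K : ℝ) + 1)⁻¹ := by
            rw [show (2 - 1 : ℕ) = 1 from rfl, pow_one]
            field_simp
            ring
        _ ≤ (4 * derivConst 2 * (d : ℝ) / (π ^ 2 * Y)) * (Y / d) :=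
            mul_le_mul_of_nonneg_left hK1 (by positivity)
        _ = derivConst 2 * (4 / π ^ 2) := by field_simp
        _ ≤ derivConst 2 * 1 :=
            mul_le_mul_of_nonneg_left ((div_le_one (by positivity)).2 hπ) (by linarith)
        _ = derivConst 2 := mul_one _
  calc ∑ d ∈ k.divisors, (d : ℝ)⁻¹ * (2 * (⌊(d : ℝ) / Y⌋₊ : ℕ) * (M + 2 * Y) +
          tailBound Y 2 d ⌊(d : ℝ) / Y⌋₊)
      ≤ ∑ d ∈ k.divisors, (2 * (M + 2 * Y) / Y + derivConst 2) := Finset.sum_le_sum hterm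
    _ = (2 * (M + 2 * Y) / Y + derivConst 2) * (σ 0 k : ℝ) := by
        rw [Finset.sum_const, nsmul_eq_mul, ArithmeticFunction.sigma_zero_apply, mul_comm]

/-- For BFI's weight, `A₃(r, q₁, q₂) = [(q₁q₂r, a) = 1] · A*(q₁q₂r)` (`A* = BFI.coprimeSum`).
[folklore] -/
theorem mA3_bump_eq (a : ℤ) (M Y : ℝ) (r q₁ q₂ : ℕ) :
    mA3 a (mRange M Y) (fun m => bump M Y m) r q₁ q₂ =
      if IsCoprime ((q₁ * q₂ * r : ℕ) : ℤ) a then coprimeSum M Y (q₁ * q₂ * r) else 0 := by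
  rw [mA3_eq]
  rfl

/-! ### `𝒮₃ = f̂(0) X + ℛ₃` (BFI (4.1)–(4.2)) -/

/-- One term of `𝒮₃ − f̂(0) X`: for `r, q₁, q₂ ≥ 1`,
`‖γγ (c₁/φ₁)(c₂/φ₂) A₃ − α̂₀ [cop] γγ (c₁/φ₁)(c₂/φ₂) φ(k)/k‖ ≤ (2(M+2Y)/Y + K₂) |γ₁γ₂| τ(k) (∑|β|)²/(φ₁φ₂)`
(`k = q₁q₂r`, `cᵢ = ∑_{(n,qᵢr)=1} β_n`, `φᵢ = φ(qᵢr)`). [cite: BombieriFriedlanderIwaniecActa1986, §4 (4.1)–(4.2) p. 216] -/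
theorem norm_dS3_term_sub_le {M Y : ℝ} (hY : 0 < Y) (hYM : Y ≤ M) (a : ℤ) (N : ℝ) (β γ : ℕ → ℝ)
    {r q₁ q₂ : ℕ} (hr : 0 < r) (hq₁ : 0 < q₁) (hq₂ : 0 < q₂) :
    ‖((γ q₁ * γ q₂ * (cSum N β (q₁ * r) / (Nat.totient (q₁ * r) : ℝ)) *
          (cSum N β (q₂ * r) / (Nat.totient (q₂ * r) : ℝ)) *
          mA3 a (mRange M Y) (fun m => bump M Y m) r q₁ q₂ : ℝ) : ℂ) -
        alphaHat M Y *
          ((if IsCoprime ((q₁ * q₂ * r : ℕ) : ℤ) a then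
              γ q₁ * γ q₂ * (cSum N β (q₁ * r) / (Nat.totient (q₁ * r) : ℝ)) *
                (cSum N β (q₂ * r) / (Nat.totient (q₂ * r) : ℝ)) *
                ((Nat.totient (q₁ * q₂ * r) : ℝ) / ((q₁ * q₂ * r : ℕ) : ℝ))
            else 0 : ℝ) : ℂ)‖ ≤
      (2 * (M + 2 * Y) / Y + derivConst 2) *
        (|γ q₁| * |γ q₂| * (σ 0 (q₁ * q₂ * r) : ℝ) * (∑ n ∈ dyadic N, |β n|) ^ 2 /
          ((Nat.totient (q₁ * r) : ℝ) * (Nat.totient (q₂ * r) : ℝ))) := by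
  have hk : 0 < q₁ * q₂ * r := Nat.mul_pos (Nat.mul_pos hq₁ hq₂) hr
  set u : ℝ := γ q₁ * γ q₂ * (cSum N β (q₁ * r) / (Nat.totient (q₁ * r) : ℝ)) *
    (cSum N β (q₂ * r) / (Nat.totient (q₂ * r) : ℝ)) with hu
  have hφ₁ : (0 : ℝ) < (Nat.totient (q₁ * r) : ℝ) := by
    exact_mod_cast Nat.totient_pos.2 (Nat.mul_pos hq₁ hr)
  have hφ₂ : (0 : ℝ) < (Nat.totient (q₂ * r) : ℝ) := by
    exact_mod_cast Nat.totient_pos.2 (Nat.mul_pos hq₂ hr)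
  have hS := Finset.sum_nonneg (fun n (_ : n ∈ dyadic N) => abs_nonneg (β n))
  have hu_le : |u| ≤ |γ q₁| * |γ q₂| * (∑ n ∈ dyadic N, |β n|) ^ 2 /
      ((Nat.totient (q₁ * r) : ℝ) * (Nat.totient (q₂ * r) : ℝ)) := by
    rw [hu, abs_mul, abs_mul, abs_mul, abs_div, abs_div, abs_of_pos hφ₁, abs_of_pos hφ₂]
    have h1 := abs_cSum_le N β (q₁ * r)
    have h2 := abs_cSum_le N β (q₂ * r)
    calc |γ q₁| * |γ q₂| * (|cSum N β (q₁ * r)| / (Nat.totient (q₁ * r) : ℝ)) *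
          (|cSum N β (q₂ * r)| / (Nat.totient (q₂ * r) : ℝ))
        ≤ |γ q₁| * |γ q₂| * ((∑ n ∈ dyadic N, |β n|) / (Nat.totient (q₁ * r) : ℝ)) *
          ((∑ n ∈ dyadic N, |β n|) / (Nat.totient (q₂ * r) : ℝ)) := by gcongr
      _ = _ := by rw [sq]; field_simp
  rw [mA3_bump_eq]
  by_cases hcop : IsCoprime ((q₁ * q₂ * r : ℕ) : ℤ) a
  · rw [if_pos hcop, if_pos hcop]
    have e : ((u * coprimeSum M Y (q₁ * q₂ * r) : ℝ) : ℂ) -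
        alphaHat M Y * ((u * ((Nat.totient (q₁ * q₂ * r) : ℝ) / ((q₁ * q₂ * r : ℕ) : ℝ)) : ℝ) : ℂ) =
        (u : ℂ) * ((coprimeSum M Y (q₁ * q₂ * r) : ℂ) -
          alphaHat M Y * ((Nat.totient (q₁ * q₂ * r) : ℂ) / ((q₁ * q₂ * r : ℕ) : ℂ))) := by
      push_cast
      ring
    rw [e, norm_mul, Complex.norm_real, Real.norm_eq_abs]
    have hmain := norm_coprimeSum_sub_le_sigma hY hYM hk
    calc |u| * ‖(coprimeSum M Y (q₁ * q₂ * r) : ℂ) -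
            alphaHat M Y * ((Nat.totient (q₁ * q₂ * r) : ℂ) / ((q₁ * q₂ * r : ℕ) : ℂ))‖
        ≤ (|γ q₁| * |γ q₂| * (∑ n ∈ dyadic N, |β n|) ^ 2 /
            ((Nat.totient (q₁ * r) : ℝ) * (Nat.totient (q₂ * r) : ℝ))) *
            ((2 * (M + 2 * Y) / Y + derivConst 2) * (σ 0 (q₁ * q₂ * r) : ℝ)) := by
          refine mul_le_mul hu_le ?_ (norm_nonneg _) (by positivity)
          exact_mod_cast hmain
      _ = _ := by ring
  · rw [if_neg hcop, if_neg hcop]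
    simp only [mul_zero, Complex.ofReal_zero, sub_zero, norm_zero]
    have := one_le_derivConst 2
    have hM : 0 ≤ M := hY.le.trans hYM
    positivity

/-- **`𝒮₃ = f̂(0) X + ℛ₃`** (BFI (4.1)–(4.2), p. 216: "This yields `𝒮₃ = f̂(0)X + ℛ₃` where … The error
term `ℛ₃` is bounded by `ℛ₃ ≪ N‖β‖²R⁻¹ℒ^B` which is admissible for (3.3)"), in the explicit form:
for BFI's weight `f = bump M Y` (`0 < Y ≤ M`) and `Q, R ≥ 0`,
`‖𝒮₃ − α̂₀ X‖ ≤ (2(M+2Y)/Y + K₂) ∑_{r∼R} ∑_{q₁,q₂∼Q} |γ_{q₁}γ_{q₂}| τ(q₁q₂r) (∑_{n∼N}|β_n|)² / (φ(q₁r)φ(q₂r))`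
(`α̂₀ = f̂(0)`; the averaging of the right-hand side to `≪ N‖β‖²R⁻¹ℒ^B` under (A₃) is done where it is
used). [cite: BombieriFriedlanderIwaniecActa1986, §4 (4.1)–(4.2) p. 216] -/
theorem norm_dS3_sub_mainX_le {M Y : ℝ} (hY : 0 < Y) (hYM : Y ≤ M) (a : ℤ) {N Q R : ℝ}
    (hQ : 0 ≤ Q) (hR : 0 ≤ R) (β γ : ℕ → ℝ) :
    ‖(dS3 a (mRange M Y) N Q R (fun m => bump M Y m) β γ : ℂ) -
        alphaHat M Y * (mainX a N Q R β γ : ℂ)‖ ≤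
      (2 * (M + 2 * Y) / Y + derivConst 2) *
        ∑ r ∈ dyadic R, ∑ q₁ ∈ dyadic Q, ∑ q₂ ∈ dyadic Q,
          |γ q₁| * |γ q₂| * (σ 0 (q₁ * q₂ * r) : ℝ) * (∑ n ∈ dyadic N, |β n|) ^ 2 /
            ((Nat.totient (q₁ * r) : ℝ) * (Nat.totient (q₂ * r) : ℝ)) := by
  rw [dS3_eq, mainX]
  push_cast
  simp only [Finset.mul_sum, ← Finset.sum_sub_distrib]
  refine (norm_sum_le _ _).trans (Finset.sum_le_sum fun r hr => ?_)
  refine (norm_sum_le _ _).trans (Finset.sum_le_sum fun q₁ hq₁ => ?_)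
  refine (norm_sum_le _ _).trans (Finset.sum_le_sum fun q₂ hq₂ => ?_)
  have hr0 := pos_of_mem_dyadic hR hr
  have hq₁0 := pos_of_mem_dyadic hQ hq₁
  have hq₂0 := pos_of_mem_dyadic hQ hq₂
  have h := norm_dS3_term_sub_le hY hYM a N β γ hr0 hq₁0 hq₂0
  push_cast at h
  convert h using 2

end BFI

end Literature.NumberTheory.Sieve
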